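import Summits.PneNP.PneNP.Theorems.CodingVolumeShiftsCodingVolumeCondEntropy
import Summits.PneNP.PneNP.Theorems.CodingVolumeShiftsCodingVolumeDeparture

/-!
# Route CodingVolumeShifts — crux `CodingVolume` (stmt-PneNP-19454): the per-vertex entropy credit
# (general one-shot codes)

The per-vertex inequality of the entropy form of the `C = 4` volume argument for an ARBITRARY
binary one-shot code `c : N.Code` on a `4`-far k-pairs network (entropy translation of
`codingVolume_linear_vertex`). Inputs `x` are uniform on the cube `ι → Bool`; for a finite set `Q`
of commodities `x|_Q` is the masked tuple `j ↦ if j ∈ Q then x j else false`, and for a finite set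
`E` of arcs the bits on `E` are `b ↦ if b ∈ E then c.val b x else false`. With the LEVEL `hr i` of a
commodity (least rank of a middle vertex receiving an effective arc from `source i`), `B = {hr < r}`,
`B' = {hr < r + 1}`, `A1` = level-`r` commodities with a unique entry vertex,
`C = B ∪ (level r ∖ A1)`, and for a middle vertex `v`: `In v` = arcs into `v`, `T` = level-`r`
commodities with an effective arc into `v`, `P` = level-`r` commodities whose sink has a single
in-arc, with tail `v`, `UA` = arcs into `v` from rank-`r` middle vertices,

`codingVolume_entropy_vertex`:
`H(In v | x|_{B'}) + |T| + H(UA | x|_C) + |P| ≤ H(In v | x|_B)`.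

Proof: the credit lemma with the common part `W = (x|_P, (UA, x|_T))` of `In v` and `x|_{B'}`;
`H(W | x|_B) = |T| + H(UA | x|_T, x|_B) + |P|` by the chain rule and fresh bits (`(UA, x|_T, x|_B)`
ignores the coordinates `P`, by `Far 4`); and `H(UA | x|_T, x|_B) ≥ H(UA | x|_C)` (if some `T`-commodity
is in `A1` then `v` has rank `r` and `UA = ∅`; otherwise `T ⊆ C`). No definitions. [folklore]
-/

set_option linter.dupNamespace false -- `Summit.PneNP.PneNP.…`: summit = sub-problem name (D-0017)

namespace Summit.PneNP.PneNP.Theorems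

open Literature.InformationTheory.NetworkCoding Literature.InformationTheory.Entropy Finset

section Credit

variable {ι : Type} [Fintype ι] [DecidableEq ι] {N : KPairsNet ι}

/-- **PER-VERTEX ENTROPY CREDIT** (see the module docstring for the notation):
`H(In v | x|_{B'}) + |T| + H(UA | x|_C) + |P| ≤ H(In v | x|_B)` for every non-sink vertex `v` of a
`4`-far network carrying the one-shot code `c`, at every level `r`. [folklore] -/
theorem codingVolume_entropy_vertex (c : N.Code) (hfar : N.Far 4) (hr : ι → ℕ)
    (hrA : ∀ i, ∃ a, N.src a = N.source i ∧ (∀ l, N.tgt a ≠ N.sink l) ∧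
      (∃ y y' : ι → Bool, c.val a y ≠ c.val a y') ∧ N.rank (N.tgt a) = hr i)
    (hhr : ∀ i a, N.src a = N.source i → (∀ l, N.tgt a ≠ N.sink l) →
      (∃ y y' : ι → Bool, c.val a y ≠ c.val a y') → hr i ≤ N.rank (N.tgt a))
    (r : ℕ) (A1 : Finset ι)
    (hA1 : ∀ j, j ∈ A1 ↔ hr j = r ∧ ∀ a a', N.src a = N.source j → N.src a' = N.source j →
      (∀ l, N.tgt a ≠ N.sink l) → (∀ l, N.tgt a' ≠ N.sink l) →
      (∃ y y' : ι → Bool, c.val a y ≠ c.val a y') → (∃ y y' : ι → Bool, c.val a' y ≠ c.val a' y') →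
      N.tgt a = N.tgt a')
    (B B' C : Finset ι) (hB : ∀ j, j ∈ B ↔ hr j < r) (hB' : ∀ j, j ∈ B' ↔ hr j < r + 1)
    (hC : ∀ j, j ∈ C ↔ hr j < r ∨ (hr j = r ∧ j ∉ A1))
    (v : N.V) (hvt : ∀ j, v ≠ N.sink j)
    (T : Finset ι) (hT : ∀ i, i ∈ T ↔ hr i = r ∧ ∃ a, N.src a = N.source i ∧ N.tgt a = v ∧
      ∃ y y' : ι → Bool, c.val a y ≠ c.val a y')
    (P : Finset ι) (hP : ∀ i, i ∈ P ↔ hr i = r ∧ (N.inArcs (N.sink i)).card ≤ 1 ∧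
      ∃ b ∈ N.inArcs (N.sink i), N.src b = v)
    (UA : Finset N.A) (hUA : ∀ b, b ∈ UA ↔ N.tgt b = v ∧ (∀ j, N.src b ≠ N.source j) ∧
      N.rank (N.src b) = r) :
    (mapEntropy (univ : Finset (ι → Bool)) (fun x => ((fun b => if b ∈ N.inArcs v then c.val b x
        else false), (fun j => if j ∈ B' then x j else false))) -
      mapEntropy (univ : Finset (ι → Bool)) (fun x => fun j => if j ∈ B' then x j else false)) +
    T.card +
    (mapEntropy (univ : Finset (ι → Bool)) (fun x => ((fun b => if b ∈ UA then c.val b x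
        else false), (fun j => if j ∈ C then x j else false))) -
      mapEntropy (univ : Finset (ι → Bool)) (fun x => fun j => if j ∈ C then x j else false)) +
    P.card ≤
    mapEntropy (univ : Finset (ι → Bool)) (fun x => ((fun b => if b ∈ N.inArcs v then c.val b x
        else false), (fun j => if j ∈ B then x j else false))) -
      mapEntropy (univ : Finset (ι → Bool)) (fun x => fun j => if j ∈ B then x j else false) := by
  classical
  -- the random variables
  let In : (ι → Bool) → (N.A → Bool) := fun x b => if b ∈ N.inArcs v then c.val b x else false
  let U : (ι → Bool) → (N.A → Bool) := fun x b => if b ∈ UA then c.val b x else false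
  let xB : (ι → Bool) → (ι → Bool) := fun x j => if j ∈ B then x j else false
  let xB' : (ι → Bool) → (ι → Bool) := fun x j => if j ∈ B' then x j else false
  let xC : (ι → Bool) → (ι → Bool) := fun x j => if j ∈ C then x j else false
  let xT : (ι → Bool) → (ι → Bool) := fun x j => if j ∈ T then x j else false
  let xP : (ι → Bool) → (ι → Bool) := fun x j => if j ∈ P then x j else false
  let W : (ι → Bool) → (ι → Bool) × ((N.A → Bool) × (ι → Bool)) := fun x => (xP x, (U x, xT x))
  have hfar2 : ∀ i, (2 : ℕ∞) ≤ N.graph.edist (N.source i) (N.sink i) := fun i =>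
    le_trans (by exact_mod_cast (by norm_num : (2 : ℕ) ≤ 4)) (hfar i)
  -- (0) unpacking equalities of masked tuples
  have hmaskA : ∀ (E : Finset N.A) (x x' : ι → Bool),
      ((fun b => if b ∈ E then c.val b x else false) = fun b => if b ∈ E then c.val b x' else false) ↔
        ∀ b ∈ E, c.val b x = c.val b x' :=
    fun E x x' => codingVolume_mask_eq_iff E (fun x b => c.val b x) x x'
  have hmaskI : ∀ (Q : Finset ι) (x x' : ι → Bool),
      ((fun j => if j ∈ Q then x j else false) = fun j => if j ∈ Q then x' j else false) ↔
        ∀ j ∈ Q, x j = x' j :=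
    fun Q x x' => codingVolume_mask_eq_iff Q (fun x j => x j) x x'
  -- (1) structural facts
  -- `T`: an effective arc `source i → v` is a literal of `x_i` entering `v`
  have hT_det : ∀ i ∈ T, ∀ x x' : ι → Bool, (∀ b ∈ N.inArcs v, c.val b x = c.val b x') →
      x i = x' i := by
    intro i hi x x' h
    obtain ⟨-, a, ha, hav, hae⟩ := (hT i).mp hi
    obtain ⟨neg, hlit⟩ := codingVolume_source_arc_literal c a ha hae
    have hb : a ∈ N.inArcs v := by simp [KPairsNet.inArcs, hav]
    have := h a hb
    rw [hlit, hlit] at this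
    simpa using this
  -- `P`: the single in-arc of `sink i` has tail `v`, and the in-arcs of `v` determine `x_i`
  have hP_arc : ∀ i ∈ P, ∃ b, N.inArcs (N.sink i) = {b} ∧ N.src b = v := by
    intro i hi
    obtain ⟨-, hcard, b, hb, hbv⟩ := (hP i).mp hi
    have h1 : (N.inArcs (N.sink i)).card = 1 :=
      le_antisymm hcard (Finset.card_pos.mpr ⟨b, hb⟩)
    obtain ⟨b', hb'⟩ := Finset.card_eq_one.mp h1
    rw [hb', Finset.mem_singleton] at hb
    subst hb
    exact ⟨b, hb', hbv⟩
  have hP_det : ∀ i ∈ P, ∀ x x' : ι → Bool, (∀ b ∈ N.inArcs v, c.val b x = c.val b x') →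
      x i = x' i := by
    intro i hi x x' h
    obtain ⟨b, hb, hbv⟩ := hP_arc i hi
    obtain ⟨-, -, hdet⟩ := codingVolume_single_inArc_tail c i b hb (hfar2 i)
    refine hdet x x' (fun b' hb' => h b' ?_)
    simp [KPairsNet.inArcs, hb', hbv]
  -- arcs of `UA`: out-support at level `r`
  have hU_dep : ∀ b ∈ UA, ∀ x x' : ι → Bool,
      (∀ j, ((∃ a, N.src a = N.source j ∧ N.tgt a = N.src b ∧
        ∃ y y' : ι → Bool, c.val a y ≠ c.val a y') ∨ hr j < r) → x j = x' j) →
      c.val b x = c.val b x' := by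
    intro b hb x x' h
    obtain ⟨-, hbM, hbr⟩ := (hUA b).mp hb
    exact codingVolume_val_eq_of_agree_entry c hr hhr r b hbM hbr h
  -- a commodity with an effective arc into the tail of a `UA`-arc has level `≤ r`
  have hU_lev : ∀ b ∈ UA, ∀ j a, N.src a = N.source j → N.tgt a = N.src b →
      (∃ y y' : ι → Bool, c.val a y ≠ c.val a y') → hr j ≤ r := by
    intro b hb j a ha hat hae
    obtain ⟨-, -, hbr⟩ := (hUA b).mp hb
    have := hhr j a ha (fun l hl => N.sink_out b l (hat.symm.trans hl)) hae
    rwa [hat, hbr] at this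
  -- distances: `T ∩ P = ∅`, and no `UA`-arc depends on a `P`-commodity
  have hTP : ∀ i ∈ T, i ∉ P := by
    intro i hi hiP
    obtain ⟨-, a, ha, hav, -⟩ := (hT i).mp hi
    obtain ⟨b, hb, hbv⟩ := hP_arc i hiP
    have hbt : N.tgt b = N.sink i := by
      have : b ∈ N.inArcs (N.sink i) := by rw [hb]; exact Finset.mem_singleton_self b
      simpa [KPairsNet.inArcs] using this
    have h1 : N.graph.Adj (N.source i) v := by rw [← ha, ← hav]; exact codingVolume_adj_arc a
    have h2 : N.graph.Adj v (N.sink i) := by rw [← hbv, ← hbt]; exact codingVolume_adj_arc b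
    have hw := codingVolume_le_length_of_far (hfar i)
      (SimpleGraph.Walk.cons h1 (SimpleGraph.Walk.cons h2 SimpleGraph.Walk.nil))
    simp at hw
  have hUP : ∀ b ∈ UA, ∀ j a, N.src a = N.source j → N.tgt a = N.src b → j ∉ P := by
    intro b hb j a ha hat hjP
    obtain ⟨hbv, -, -⟩ := (hUA b).mp hb
    obtain ⟨b', hb', hb'v⟩ := hP_arc j hjP
    have hbt : N.tgt b' = N.sink j := by
      have : b' ∈ N.inArcs (N.sink j) := by rw [hb']; exact Finset.mem_singleton_self b'
      simpa [KPairsNet.inArcs] using this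
    have h1 : N.graph.Adj (N.source j) (N.src b) := by
      rw [← ha, ← hat]; exact codingVolume_adj_arc a
    have h2 : N.graph.Adj (N.src b) v := by rw [← hbv]; exact codingVolume_adj_arc b
    have h3 : N.graph.Adj v (N.sink j) := by rw [← hb'v, ← hbt]; exact codingVolume_adj_arc b'
    have hw := codingVolume_le_length_of_far (hfar j)
      (SimpleGraph.Walk.cons h1 (SimpleGraph.Walk.cons h2
        (SimpleGraph.Walk.cons h3 SimpleGraph.Walk.nil)))
    simp at hw
  -- (2) the credit lemma: `H(W | xB) ≤ H(In | xB) − H(In | xB')`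
  have hwf : ∀ x ∈ (univ : Finset (ι → Bool)), ∀ x' ∈ (univ : Finset (ι → Bool)),
      In x = In x' → W x = W x' := by
    intro x _ x' _ h
    have h' : ∀ b ∈ N.inArcs v, c.val b x = c.val b x' := (hmaskA _ x x').mp h
    refine Prod.ext ((hmaskI P x x').mpr fun i hi => hP_det i hi x x' h') (Prod.ext ?_ ?_)
    · refine (hmaskA UA x x').mpr fun b hb => h' b ?_
      obtain ⟨hbv, -, -⟩ := (hUA b).mp hb
      simp [KPairsNet.inArcs, hbv]
    · exact (hmaskI T x x').mpr fun i hi => hT_det i hi x x' h'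
  have hwk : ∀ x ∈ (univ : Finset (ι → Bool)), ∀ x' ∈ (univ : Finset (ι → Bool)),
      xB' x = xB' x' → W x = W x' := by
    intro x _ x' _ h
    have h' : ∀ j, hr j ≤ r → x j = x' j := fun j hj =>
      (hmaskI B' x x').mp h j ((hB' j).mpr (Nat.lt_succ_of_le hj))
    refine Prod.ext ((hmaskI P x x').mpr fun i hi => h' i ((hP i).mp hi).1.le) (Prod.ext ?_ ?_)
    · refine (hmaskA UA x x').mpr fun b hb => hU_dep b hb x x' fun j hj => ?_
      rcases hj with ⟨a, ha, hat, hae⟩ | hj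
      · exact h' j (hU_lev b hb j a ha hat hae)
      · exact h' j hj.le
    · exact (hmaskI T x x').mpr fun i hi => h' i ((hT i).mp hi).1.le
  have hkk : ∀ x ∈ (univ : Finset (ι → Bool)), ∀ x' ∈ (univ : Finset (ι → Bool)),
      xB' x = xB' x' → xB x = xB x' := by
    intro x _ x' _ h
    exact (hmaskI B x x').mpr fun j hj =>
      (hmaskI B' x x').mp h j ((hB' j).mpr (Nat.lt_succ_of_lt ((hB j).mp hj)))
  have hcredit : mapEntropy univ (fun x => (W x, xB x)) - mapEntropy univ xB ≤
      (mapEntropy univ (fun x => (In x, xB x)) - mapEntropy univ xB) -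
      (mapEntropy univ (fun x => (In x, xB' x)) - mapEntropy univ xB') :=
    codingVolume_ent_credit univ In W xB xB' hwf hwk hkk
  -- (3) `H(W | xB) = [H((U, xT) | xB)] + [H(xP | (U, xT), xB)]` and the second term is `|P|`
  have hchain1 : mapEntropy univ (fun x => (W x, xB x)) - mapEntropy univ xB =
      (mapEntropy univ (fun x => ((U x, xT x), xB x)) - mapEntropy univ xB) +
      (mapEntropy univ (fun x => (xP x, ((U x, xT x), xB x))) -
        mapEntropy univ (fun x => ((U x, xT x), xB x))) :=
    codingVolume_ent_chain univ xP (fun x => (U x, xT x)) xB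
  have hPfresh : mapEntropy univ (fun x => (xP x, ((U x, xT x), xB x))) -
      mapEntropy univ (fun x => ((U x, xT x), xB x)) = P.card := by
    refine codingVolume_ent_coords_cond P (fun x => ((U x, xT x), xB x)) fun x x' h => ?_
    refine Prod.ext (Prod.ext ?_ ?_) ?_
    · refine (hmaskA UA x x').mpr fun b hb => hU_dep b hb x x' fun j hj => h j ?_
      rcases hj with ⟨a, ha, hat, -⟩ | hj
      · exact hUP b hb j a ha hat
      · exact fun hjP => absurd ((hP j).mp hjP).1 (Nat.ne_of_lt hj)
    · exact (hmaskI T x x').mpr fun i hi => h i (hTP i hi)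
    · exact (hmaskI B x x').mpr fun j hj => h j fun hjP =>
        absurd ((hP j).mp hjP).1 (Nat.ne_of_lt ((hB j).mp hj))
  -- (4) `H((U, xT) | xB) = |T| + H(U | xT, xB)`
  have hchain2 : mapEntropy univ (fun x => ((U x, xT x), xB x)) - mapEntropy univ xB =
      (mapEntropy univ (fun x => (xT x, xB x)) - mapEntropy univ xB) +
      (mapEntropy univ (fun x => (U x, (xT x, xB x))) - mapEntropy univ (fun x => (xT x, xB x))) :=
    codingVolume_ent_chain univ U xT xB
  have hTfresh : mapEntropy univ (fun x => (xT x, xB x)) - mapEntropy univ xB = T.card := by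
    refine codingVolume_ent_coords_cond T xB fun x x' h => ?_
    exact (hmaskI B x x').mpr fun j hj => h j fun hjT =>
      absurd ((hT j).mp hjT).1 (Nat.ne_of_lt ((hB j).mp hj))
  -- (5) `H(U | xT, xB) ≥ H(U | xC)`
  have hUC : mapEntropy univ (fun x => (U x, xC x)) - mapEntropy univ xC ≤
      mapEntropy univ (fun x => (U x, (xT x, xB x))) - mapEntropy univ (fun x => (xT x, xB x)) := by
    by_cases hcase : ∃ i ∈ T, i ∈ A1
    · -- `v` is the entry vertex of an `A1`-commodity: rank `r`, so `UA = ∅`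
      obtain ⟨i, hiT, hiA⟩ := hcase
      obtain ⟨hir, a, ha, hav, hae⟩ := (hT i).mp hiT
      have hrank : N.rank v = r := by
        obtain ⟨a₀, ha₀, hM₀, hae₀, hrk₀⟩ := hrA i
        have huniq := ((hA1 i).mp hiA).2 a a₀ ha ha₀ (fun l hl => hvt l (by rw [← hl, hav])) hM₀
          hae hae₀
        rw [← hav, huniq, hrk₀, hir]
      have hUAe : ∀ b, b ∉ UA := by
        intro b hb
        obtain ⟨hbv, -, hbr⟩ := (hUA b).mp hb
        have := N.rank_lt b
        rw [hbr, hbv, hrank] at this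
        exact lt_irrefl _ this
      have h0 : mapEntropy univ (fun x => (U x, xC x)) - mapEntropy univ xC = 0 :=
        codingVolume_ent_cond_eq_zero univ U xC fun x _ x' _ _ =>
          (hmaskA UA x x').mpr fun b hb => absurd hb (hUAe b)
      have h1 := codingVolume_ent_cond_nonneg univ U (fun x => (xT x, xB x))
      linarith
    · -- no `A1`-commodity enters at `v`: `T ⊆ C`, so `(xT, xB)` is a function of `xC`
      push Not at hcase
      refine codingVolume_ent_cond_le_of_determined univ U xC (fun x => (xT x, xB x))
        fun x _ x' _ h => ?_
      have h' : ∀ j ∈ C, x j = x' j := (hmaskI C x x').mp h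
      refine Prod.ext ?_ ?_
      · exact (hmaskI T x x').mpr fun i hi =>
          h' i ((hC i).mpr (Or.inr ⟨((hT i).mp hi).1, hcase i hi⟩))
      · exact (hmaskI B x x').mpr fun j hj => h' j ((hC j).mpr (Or.inl ((hB j).mp hj)))
  -- (6) assemble
  have key : (mapEntropy univ (fun x => (In x, xB' x)) - mapEntropy univ xB') + T.card +
      (mapEntropy univ (fun x => (U x, xC x)) - mapEntropy univ xC) + P.card ≤
      mapEntropy univ (fun x => (In x, xB x)) - mapEntropy univ xB := by
    linarith
  exact key

end Credit

end Summit.PneNP.PneNP.Theorems
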